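import Summits.RiemannHypothesis.RiemannHypothesis.Theorems.HandoffPrimeShadowBT
import HarnessLib

/-!
# HANDOFF — the arithmetic shadow, LOWER half unweighted: primes in every short interval below the window (PNT in short intervals, RH quality)
# (rh-explicit, TRACK «HANDOFF», seat prove-2 gen4, ATTEMPT-11 §3(f))

HONEST FRAMING. Nothing here bears on RH. Companion of `HandoffPrimeShadowBT.lean` (the UPPER Brun–Titchmarsh inequality with constant `→ 1`).
Same two flat lobes `u = flatLobe k₁ r₁ (L/2)` (narrow), `h = flatLobe k₂ r₂ (−L/2)` (wide), `r₁ ≤ r₂ ≤ 1/4`, `2r₂ < L`; now the OTHER sign of the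
dipole test (`0 ≤ Re Q(u − τh)`) bounds the windowed sum from BELOW: the cross kernel is `≤ ∫u = r₁M_{k₁}` everywhere and supported in
`[L − r₁ − r₂, L + r₁ + r₂]`, and the polar term is EXACTLY `(e^{L/2} + e^{−L/2})·m₁m₂` with `mᵢ = f̂ᵢ(1) ≥ e^{−rᵢ/2}rᵢM_{kᵢ}` real, so

`(e^{L/2} + e^{−L/2})·e^{−r₁/2}e^{−r₂/2}·r₁r₂M_{k₁}M_{k₂} − 4r₂M(L/2 − r₂)(r₁N₁ + r₂N₂) − (ℓ₁r₁N₁ + τ²ℓ₂r₂N₂)/(2τ)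
   ≤ r₁M_{k₁} · Σ_{e^{L − r₁ − r₂} ≤ n ≤ e^{L + r₁ + r₂}} Λ(n)/√n`

(`sharp_window_sum_ge`). Dividing by `r₁M_{k₁}`: at least `(M_{k₂}/2)·(r₂/(r₁ + r₂))·e^{−(r₁+r₂)/2} → 1` times the expected `2(r₁ + r₂)·(e^{L/2} + e^{−L/2})`
worth of prime powers in `[x e^{−(r₁+r₂)}, x e^{r₁+r₂}]`, minus a fluctuation `≍ √x·√(r₂/r₁)·log(x/h)` — the RH form of the prime number theorem in short
intervals (constant `→ 1`), for every `x ≤ e^{2a − 2r₂}`, from `WeilPositivityOn a` alone. Its qualitative corner (`> 0`) is Cramér's bound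
(`HandoffPrimeShadowFlat.mul_exp_le_of_primePowerFree`; gen2–3 for the window's own gap).

References: Montgomery–Vaughan (2007) §13.1, Thm 13.3 (Cramér) and its proof (13.11)–(13.13) — the printed RH form of the smoothed short-interval
prime count with the triangular weight (`MontgomeryVaughan2007`); Bombieri (2000) §3 (`Bombieri2000Weil`). NO new definitions.
-/

set_option linter.dupNamespace false  -- the mandated namespace repeats `RiemannHypothesis`

noncomputable section

open Set Filter Complex MeasureTheory Metric Literature.NumberTheory.LFunctions
open Summit.RiemannHypothesis.RiemannHypothesis.Theorems.Handoff
open Summit.RiemannHypothesis.RiemannHypothesis.Theorems.HandoffCapSharp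
open scoped Real ComplexConjugate ArithmeticFunction.vonMangoldt

namespace Summit.RiemannHypothesis.RiemannHypothesis.Theorems.HandoffPrimeShadow

variable {k k₁ k₂ : ℕ} {r r₁ r₂ L : ℝ}

/-! ## §1 The centred flat lobe's transform at a real point is real and bounded below -/

/-- `f̂(σ)` is REAL for `f = flatLobe k r 0` and real `σ`. [folklore] -/
theorem weilMellin_flatLobe_zero_ofReal (k : ℕ) (r σ : ℝ) :
    weilMellin (flatLobe k r 0) (σ : ℂ) = (((weilMellin (flatLobe k r 0) (σ : ℂ)).re : ℝ) : ℂ) := by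
  have e : (fun t : ℝ ↦ flatLobe k r 0 t * cexp (((σ : ℂ) - 1 / 2) * (t : ℂ))) =
      fun t : ℝ ↦ (((flatBump k) (t / r) * Real.exp ((σ - 1 / 2) * t) : ℝ) : ℂ) := by
    funext t
    rw [show ((σ : ℂ) - 1 / 2) * (t : ℂ) = (((σ - 1 / 2) * t : ℝ) : ℂ) by push_cast; ring, ← Complex.ofReal_exp]
    simp only [flatLobe, flatProfile, sub_zero]
    push_cast
    ring
  unfold weilMellin
  rw [e, integral_complex_ofReal, Complex.ofReal_re]

/-- `Re f̂(σ) ≥ e^{−r|σ−½|}·r·M_k` for `f = flatLobe k r 0`, `r > 0`, real `σ`. [folklore] -/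
theorem re_weilMellin_flatLobe_zero_ge (hr : 0 < r) (σ : ℝ) :
    Real.exp (-(r * |σ - 1 / 2|)) * (r * flatMass k) ≤ (weilMellin (flatLobe k r 0) (σ : ℂ)).re := by
  rw [weilMellin_flatLobe hr 0]
  have e0 : cexp (((σ : ℂ) - 1 / 2) * ((0 : ℝ) : ℂ)) = 1 := by simp
  have e1 : (1 : ℂ) / 2 + (r : ℂ) * ((σ : ℂ) - 1 / 2) = (((1 / 2 + r * (σ - 1 / 2) : ℝ)) : ℂ) := by push_cast; ring
  rw [e0, one_mul, e1, Complex.re_ofReal_mul]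
  have h := re_weilMellin_flatProfile_real_ge k (1 / 2 + r * (σ - 1 / 2))
  rw [show (1 : ℝ) / 2 + r * (σ - 1 / 2) - 1 / 2 = r * (σ - 1 / 2) by ring, abs_mul, abs_of_pos hr] at h
  calc Real.exp (-(r * |σ - 1 / 2|)) * (r * flatMass k) = r * (Real.exp (-(r * |σ - 1 / 2|)) * flatMass k) := by ring
    _ ≤ r * (weilMellin (flatProfile k) ((1 / 2 + r * (σ - 1 / 2) : ℝ) : ℂ)).re := mul_le_mul_of_nonneg_left h hr.le

/-! ## §2 The polar term of the cross kernel, EXACTLY -/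

/-- **Polar term of `k = u ⋆ h̃`**: `Re(k̂(0) + k̂(1)) = (e^{L/2} + e^{−L/2})·m₁m₂` with `mᵢ = Re f̂ᵢ(1)` (`f̂ᵢ(0) = f̂ᵢ(1)` real for the centred lobes;
the centres `±L/2` contribute `e^{±L/4}` each). [folklore] -/
theorem re_weilPolarTerm_cross_flatLobe (hr₁ : 0 < r₁) (hr₂ : 0 < r₂) (L : ℝ) :
    (weilPolarTerm (weilConv (flatLobe k₁ r₁ (L / 2)) (weilReflect (flatLobe k₂ r₂ (-(L / 2)))))).re =
      (Real.exp (L / 2) + Real.exp (-(L / 2))) *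
        ((weilMellin (flatLobe k₁ r₁ 0) 1).re * (weilMellin (flatLobe k₂ r₂ 0) 1).re) := by
  have hu := isWeilTest_flatLobe (k := k₁) hr₁ (L / 2)
  have hh := isWeilTest_flatLobe (k := k₂) hr₂ (-(L / 2))
  -- transforms of the translated lobes in terms of the centred ones
  have hc : ∀ (kk : ℕ) {rr : ℝ}, 0 < rr → ∀ (x₀ : ℝ) (s : ℂ),
      weilMellin (flatLobe kk rr x₀) s = cexp ((s - 1 / 2) * x₀) * weilMellin (flatLobe kk rr 0) s := by
    intro kk rr hrr x₀ s
    rw [weilMellin_flatLobe hrr x₀, weilMellin_flatLobe hrr 0]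
    simp
  set m₁ := (weilMellin (flatLobe k₁ r₁ 0) 1).re with hm₁
  set m₂ := (weilMellin (flatLobe k₂ r₂ 0) 1).re with hm₂
  have h1 : weilMellin (flatLobe k₁ r₁ 0) 1 = (m₁ : ℂ) := by
    have := weilMellin_flatLobe_zero_ofReal k₁ r₁ 1
    push_cast at this
    rw [hm₁]; exact this
  have h0 : weilMellin (flatLobe k₁ r₁ 0) 0 = (m₁ : ℂ) := by rw [weilMellin_flatLobe_zero_eq_one, h1]
  have h1' : weilMellin (flatLobe k₂ r₂ 0) 1 = (m₂ : ℂ) := by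
    have := weilMellin_flatLobe_zero_ofReal k₂ r₂ 1
    push_cast at this
    rw [hm₂]; exact this
  have h0' : weilMellin (flatLobe k₂ r₂ 0) 0 = (m₂ : ℂ) := by rw [weilMellin_flatLobe_zero_eq_one, h1']
  unfold weilPolarTerm
  rw [weilMellin_weilConv_holds hu.1.continuous hu.2 hh.weilReflect.1.continuous hh.weilReflect.2,
    weilMellin_weilConv_holds hu.1.continuous hu.2 hh.weilReflect.1.continuous hh.weilReflect.2,
    weilMellin_weilReflect_holds, weilMellin_weilReflect_holds,
    show (1 : ℂ) - conj (0 : ℂ) = 1 by simp, show (1 : ℂ) - conj (1 : ℂ) = 0 by simp,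
    hc k₁ hr₁ (L / 2) 0, hc k₁ hr₁ (L / 2) 1, hc k₂ hr₂ (-(L / 2)) 1, hc k₂ hr₂ (-(L / 2)) 0, h0, h1, h0', h1']
  have ea : cexp ((0 - 1 / 2) * ((L / 2 : ℝ) : ℂ)) = ((Real.exp (-(L / 4)) : ℝ) : ℂ) := by
    rw [Complex.ofReal_exp]; congr 1; push_cast; ring
  have eb : cexp ((1 - 1 / 2) * ((-(L / 2) : ℝ) : ℂ)) = ((Real.exp (-(L / 4)) : ℝ) : ℂ) := by
    rw [Complex.ofReal_exp]; congr 1; push_cast; ring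
  have ec : cexp ((1 - 1 / 2) * ((L / 2 : ℝ) : ℂ)) = ((Real.exp (L / 4) : ℝ) : ℂ) := by
    rw [Complex.ofReal_exp]; congr 1; push_cast; ring
  have ed : cexp ((0 - 1 / 2) * ((-(L / 2) : ℝ) : ℂ)) = ((Real.exp (L / 4) : ℝ) : ℂ) := by
    rw [Complex.ofReal_exp]; congr 1; push_cast; ring
  rw [ea, eb, ec, ed]
  simp only [map_mul, Complex.conj_ofReal]
  simp only [Complex.add_re, Complex.mul_re, Complex.mul_im, Complex.ofReal_re, Complex.ofReal_im, mul_zero, zero_mul,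
    sub_zero, add_zero]
  have e4 : Real.exp (-(L / 4)) * Real.exp (-(L / 4)) = Real.exp (-(L / 2)) := by rw [← Real.exp_add]; ring_nf
  have e5 : Real.exp (L / 4) * Real.exp (L / 4) = Real.exp (L / 2) := by rw [← Real.exp_add]; ring_nf
  rw [← e4, ← e5]
  ring

/-! ## §3 The cross kernel from above, and the finite window -/

/-- The cross kernel never exceeds the probe's mass: `Re k(y) ≤ r₁M_{k₁}` (`ψ₂ ≤ 1`). [folklore] -/
theorem cross_flatLobe_re_le_mass (hr₁ : 0 < r₁) (k₂ : ℕ) (r₂ L y : ℝ) :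
    (weilConv (flatLobe k₁ r₁ (L / 2)) (weilReflect (flatLobe k₂ r₂ (-(L / 2)))) y).re ≤ r₁ * flatMass k₁ := by
  rw [cross_flatLobe_apply, Complex.ofReal_re]
  have hI := integral_flatLobe (k := k₁) hr₁ (L / 2)
  unfold flatLobe flatProfile at hI
  rw [integral_complex_ofReal] at hI
  have hI' : ∫ x : ℝ, (flatBump k₁) ((x - L / 2) / r₁) = r₁ * flatMass k₁ := by exact_mod_cast hI
  rw [← hI']
  have hint : Integrable fun x : ℝ ↦ (flatBump k₁) ((x - L / 2) / r₁) :=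
    ((flatBump k₁).integrable.comp_div hr₁.ne').comp_sub_right (L / 2)
  refine integral_mono_of_nonneg (Eventually.of_forall fun v ↦ mul_nonneg (flatBump k₁).nonneg (flatBump k₂).nonneg) hint
    (Eventually.of_forall fun v ↦ ?_)
  simpa using mul_le_mul_of_nonneg_left ((flatBump k₂).le_one (x := (v - y - -(L / 2)) / r₂))
    ((flatBump k₁).nonneg (x := (v - L / 2) / r₁))

/-- The windowed series is a finite sum over `e^{L − r₁ − r₂} ≤ n ≤ e^{L + r₁ + r₂}`. [folklore] -/
theorem tsum_cross_flatLobe_eq_sum (hr₁ : 0 < r₁) (hr₂ : 0 < r₂) :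
    ∑' n : ℕ, (Λ n : ℝ) / Real.sqrt n *
        (weilConv (flatLobe k₁ r₁ (L / 2)) (weilReflect (flatLobe k₂ r₂ (-(L / 2)))) (Real.log n)).re =
      ∑ n ∈ Finset.Icc ⌈Real.exp (L - r₁ - r₂)⌉₊ ⌊Real.exp (L + r₁ + r₂)⌋₊, (Λ n : ℝ) / Real.sqrt n *
        (weilConv (flatLobe k₁ r₁ (L / 2)) (weilReflect (flatLobe k₂ r₂ (-(L / 2)))) (Real.log n)).re := by
  refine tsum_eq_sum fun n hn ↦ ?_
  rw [Finset.mem_Icc, not_and_or, not_le, not_le] at hn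
  rcases Nat.eq_zero_or_pos n with h0 | hpos
  · subst h0; simp
  have hnR : (0 : ℝ) < n := by exact_mod_cast hpos
  rcases hn with h | h
  · have hlt : (n : ℝ) < Real.exp (L - r₁ - r₂) := Nat.lt_ceil.1 h
    have hlog : Real.log n < L - r₁ - r₂ := by rwa [Real.log_lt_iff_lt_exp hnR]
    rw [cross_flatLobe_eq_zero hr₁ hr₂ (Or.inl hlog), Complex.zero_re, mul_zero]
  · have hlt : Real.exp (L + r₁ + r₂) < n := (Nat.floor_lt (Real.exp_pos _).le).1 h
    have hlog : L + r₁ + r₂ < Real.log n := by rwa [Real.lt_log_iff_exp_lt hnR]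
    rw [cross_flatLobe_eq_zero hr₁ hr₂ (Or.inr hlog), Complex.zero_re, mul_zero]

/-- **The window upper bound for the prime term**: `Re prime(k) ≤ r₁M_{k₁}·Σ_{e^{L−r₁−r₂} ≤ n ≤ e^{L+r₁+r₂}} Λ(n)/√n`. [this track] -/
theorem re_weilPrimeTerm_le_mass_mul_sum (hr₁ : 0 < r₁) (hr₂ : 0 < r₂) (hL : r₁ + r₂ < L) :
    (weilPrimeTerm (weilConv (flatLobe k₁ r₁ (L / 2)) (weilReflect (flatLobe k₂ r₂ (-(L / 2)))))).re ≤
      r₁ * flatMass k₁ * ∑ n ∈ Finset.Icc ⌈Real.exp (L - r₁ - r₂)⌉₊ ⌊Real.exp (L + r₁ + r₂)⌋₊, (Λ n : ℝ) / Real.sqrt n := by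
  rw [re_weilPrimeTerm_cross_flatLobe hr₁ hr₂ hL, tsum_cross_flatLobe_eq_sum hr₁ hr₂, Finset.mul_sum]
  refine Finset.sum_le_sum fun n _ ↦ ?_
  have h1 := cross_flatLobe_re_le_mass (k₁ := k₁) hr₁ k₂ r₂ L (Real.log n)
  have h0 : 0 ≤ (Λ n : ℝ) / Real.sqrt n := div_nonneg ArithmeticFunction.vonMangoldt_nonneg (Real.sqrt_nonneg _)
  calc (Λ n : ℝ) / Real.sqrt n * (weilConv (flatLobe k₁ r₁ (L / 2)) (weilReflect (flatLobe k₂ r₂ (-(L / 2)))) (Real.log n)).re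
      ≤ (Λ n : ℝ) / Real.sqrt n * (r₁ * flatMass k₁) := mul_le_mul_of_nonneg_left h1 h0
    _ = r₁ * flatMass k₁ * ((Λ n : ℝ) / Real.sqrt n) := by ring

/-! ## §4 Assembly: the lower window inequality -/

/-- **SHARP WINDOW INEQUALITY FROM BELOW (two flat lobes).** For `0 < r₁ ≤ r₂ ≤ 1/4`, `2r₂ < L`, `τ > 0` and Weil positivity on `C(L/2 + r₂)`:
`(e^{L/2} + e^{−L/2})·(e^{−r₁/2}r₁M_{k₁})(e^{−r₂/2}r₂M_{k₂}) − 4r₂M(L/2 − r₂)(r₁N₁ + r₂N₂) − (ℓ₁r₁N₁ + τ²ℓ₂r₂N₂)/(2τ)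
 ≤ r₁M_{k₁}·Σ_{⌈e^{L−r₁−r₂}⌉ ≤ n ≤ ⌊e^{L+r₁+r₂}⌋} Λ(n)/√n`. Mechanism: `0 ≤ Re Q(u − τh)` gives `2τ·crossRe ≤ Re Q(u) + τ²Re Q(h)`,
`crossRe = Re polar − Re prime + Re arch` with the polar term exact (§2), `Re prime ≤ r₁M_{k₁}·Σ` (§3), the arch term exponentially small and the
flat-lobe energy ceilings. Read: every multiplicative interval `[x e^{−(r₁+r₂)}, x e^{r₁+r₂}]` below the window carries at least
`(1 − o(1))` of its expected prime mass once its length exceeds `≍ √x log x` — the prime number theorem in short intervals in its RH form, one-sidedly,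
from the window alone. [this track, ATTEMPT-11 §3(f); cite: MontgomeryVaughan2007, §13.1 Thm 13.3 (Cramér) and (13.11)–(13.13) (RH form, triangular weight)] -/
theorem sharp_window_sum_ge (k₁ k₂ : ℕ) (hr₁ : 0 < r₁) (h12 : r₁ ≤ r₂) (hr₂ : r₂ ≤ 1 / 4) (hL : 2 * r₂ < L)
    (hW : WeilPositivityOn (L / 2 + r₂)) {τ : ℝ} (hτ : 0 < τ) :
    (Real.exp (L / 2) + Real.exp (-(L / 2))) *
          ((Real.exp (-(r₁ / 2)) * (r₁ * flatMass k₁)) * (Real.exp (-(r₂ / 2)) * (r₂ * flatMass k₂))) -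
        4 * r₂ * archGapBound (L / 2 - r₂) *
          (r₁ * weilNorm2Sq (flatProfile k₁) + r₂ * weilNorm2Sq (flatProfile k₂)) -
        ((Real.log (1 / r₁) + flatEnergyConst k₁) * (r₁ * weilNorm2Sq (flatProfile k₁)) +
            τ ^ 2 * ((Real.log (1 / r₂) + flatEnergyConst k₂) * (r₂ * weilNorm2Sq (flatProfile k₂)))) / (2 * τ) ≤
      r₁ * flatMass k₁ * ∑ n ∈ Finset.Icc ⌈Real.exp (L - r₁ - r₂)⌉₊ ⌊Real.exp (L + r₁ + r₂)⌋₊, (Λ n : ℝ) / Real.sqrt n := by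
  have hr₂0 : 0 < r₂ := lt_of_lt_of_le hr₁ h12
  have hr₁4 : r₁ ≤ 1 / 4 := h12.trans hr₂
  set u := flatLobe k₁ r₁ (L / 2) with hu_def
  set h := flatLobe k₂ r₂ (-(L / 2)) with hh_def
  have hu : IsWeilTest u := isWeilTest_flatLobe hr₁ _
  have hh : IsWeilTest h := isWeilTest_flatLobe hr₂0 _
  have hsupp : ∀ t : ℝ, tsupport (u + fun x ↦ (t : ℂ) * h x) ⊆ Icc (-(L / 2 + r₂)) (L / 2 + r₂) := by
    intro t
    have h1 : tsupport u ⊆ Icc (-(L / 2 + r₂)) (L / 2 + r₂) :=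
      (tsupport_flatLobe_subset (k := k₁) hr₁ (L / 2)).trans (Icc_subset_Icc (by linarith) (by linarith))
    have h2 : tsupport (fun x ↦ (t : ℂ) * h x) ⊆ Icc (-(L / 2 + r₂)) (L / 2 + r₂) :=
      (tsupport_mul_subset_right (f := fun _ : ℝ ↦ (t : ℂ)) (g := h)).trans
        ((tsupport_flatLobe_subset (k := k₂) hr₂0 (-(L / 2))).trans (Icc_subset_Icc (by linarith) (by linarith)))
    exact (tsupport_add u (fun x ↦ (t : ℂ) * h x)).trans (union_subset h1 h2)
  have hm : 0 ≤ (weilQuadratic (u + fun x ↦ ((-τ : ℝ) : ℂ) * h x)).re :=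
    hW _ (hu.add (hh.const_mul ((-τ : ℝ) : ℂ))) (hsupp (-τ))
  rw [re_weilQuadratic_add_real_mul hu hh] at hm
  have hQu := re_weilQuadratic_flatLobe_le (k := k₁) hr₁ hr₁4 (L / 2)
  have hQh := re_weilQuadratic_flatLobe_le (k := k₂) hr₂0 hr₂ (-(L / 2))
  rw [integral_norm_sq_flatLobe hr₁] at hQu
  rw [integral_norm_sq_flatLobe hr₂0] at hQh
  have hX : crossRe u h = (weilFunctional (weilConv u (weilReflect h))).re := crossRe_eq_re_weilFunctional hu hh
  have hW3 : (weilFunctional (weilConv u (weilReflect h))).re =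
      (weilPolarTerm (weilConv u (weilReflect h))).re - (weilPrimeTerm (weilConv u (weilReflect h))).re +
        (weilArchTerm (weilConv u (weilReflect h))).re := by
    unfold weilFunctional; rw [Complex.add_re, Complex.sub_re]
  have hS := re_weilPrimeTerm_le_mass_mul_sum (k₁ := k₁) (k₂ := k₂) hr₁ hr₂0 (by linarith : r₁ + r₂ < L)
  have hP := re_weilPolarTerm_cross_flatLobe (k₁ := k₁) (k₂ := k₂) hr₁ hr₂0 L
  have hA := (neg_le.1 ((neg_le_abs _).trans ((Complex.abs_re_le_norm _).trans
    (norm_weilArchTerm_cross_flatLobe_le (k₁ := k₁) (k₂ := k₂) hr₁ h12 hL))))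
  -- the polar term from below
  have hm₁ := re_weilMellin_flatLobe_zero_ge (k := k₁) hr₁ 1
  have hm₂ := re_weilMellin_flatLobe_zero_ge (k := k₂) hr₂0 1
  rw [show |(1 : ℝ) - 1 / 2| = 1 / 2 by norm_num] at hm₁ hm₂
  rw [show r₁ * (1 / 2) = r₁ / 2 by ring] at hm₁
  rw [show r₂ * (1 / 2) = r₂ / 2 by ring] at hm₂
  have hl₁ : 0 ≤ Real.exp (-(r₁ / 2)) * (r₁ * flatMass k₁) := by
    have := one_le_flatMass k₁; positivity
  have hl₂ : 0 ≤ Real.exp (-(r₂ / 2)) * (r₂ * flatMass k₂) := by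
    have := one_le_flatMass k₂; positivity
  have hprod : (Real.exp (-(r₁ / 2)) * (r₁ * flatMass k₁)) * (Real.exp (-(r₂ / 2)) * (r₂ * flatMass k₂)) ≤
      (weilMellin (flatLobe k₁ r₁ 0) 1).re * (weilMellin (flatLobe k₂ r₂ 0) 1).re :=
    mul_le_mul hm₁ hm₂ hl₂ (hl₁.trans hm₁)
  have hcosh : 0 ≤ Real.exp (L / 2) + Real.exp (-(L / 2)) := by positivity
  have hPge : (Real.exp (L / 2) + Real.exp (-(L / 2))) *
      ((Real.exp (-(r₁ / 2)) * (r₁ * flatMass k₁)) * (Real.exp (-(r₂ / 2)) * (r₂ * flatMass k₂))) ≤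
      (weilPolarTerm (weilConv u (weilReflect h))).re := by
    rw [hP]; exact mul_le_mul_of_nonneg_left hprod hcosh
  -- the dipole with the minus sign: 2τ·X ≤ Q_u + τ²Q_h ≤ ceilings
  have hτ2 := mul_le_mul_of_nonneg_left hQh (sq_nonneg τ)
  have hXle : crossRe u h * (2 * τ) ≤
      (Real.log (1 / r₁) + flatEnergyConst k₁) * (r₁ * weilNorm2Sq (flatProfile k₁)) +
        τ ^ 2 * ((Real.log (1 / r₂) + flatEnergyConst k₂) * (r₂ * weilNorm2Sq (flatProfile k₂))) := by
    have e : (weilQuadratic h).re * ((-τ : ℝ)) ^ 2 = τ ^ 2 * (weilQuadratic h).re := by ring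
    rw [e] at hm
    linarith [hm, hQu, hτ2]
  have hdiv : crossRe u h ≤
      ((Real.log (1 / r₁) + flatEnergyConst k₁) * (r₁ * weilNorm2Sq (flatProfile k₁)) +
        τ ^ 2 * ((Real.log (1 / r₂) + flatEnergyConst k₂) * (r₂ * weilNorm2Sq (flatProfile k₂)))) / (2 * τ) := by
    rw [le_div_iff₀ (by positivity)]
    exact hXle
  have hprime : (weilPrimeTerm (weilConv u (weilReflect h))).re =
      (weilPolarTerm (weilConv u (weilReflect h))).re + (weilArchTerm (weilConv u (weilReflect h))).re - crossRe u h := by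
    linarith [hW3, hX]
  linarith [hS, hPge, hA, hdiv, hprime]

end Summit.RiemannHypothesis.RiemannHypothesis.Theorems.HandoffPrimeShadow

end
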